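import Literature.NumberTheory.EllipticCurves.CongruentNewformCuspForm
import Literature.NumberTheory.EllipticCurves.ThetaChiFour
import HarnessLib

/-!
# The congruent-number newform `φ` is a cusp form on `Γ₀(32)`

[[cite: Tunnell1983Congruent, p. 325]] — `φ = η(4z)²η(8z)² = ½ Θ′(z) · θ(4z + ½)` is the newform
of the conductor-`32` curve `E : y² = x³ - x`; the tree realised it as `congruentCuspForm :
CuspForm (Γ₀(64)) 2` (`CongruentNewformCuspForm`).  Here we PROVE the level `32`: since
`Γ₀(32) = Γ₀(64) ∪ Γ₀(64)·γ₀`, `γ₀ = (1 0; 32 1)`, it suffices to show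
`φ(γ₀ z) = (32 z + 1)² φ(z)` (`congruentPhi_gamma0`), which follows from the two theta laws with
`4 ∣ c` available in the tree:

* `Θ′(γ₀ z)` by `ThetaChiFour.thetaChi_smul_eq_tsum` (`c = 32`) and the Gauss lemmas, with the
  one new value `H(1; 32) = ∑_{s mod 32} χ₋₄(s+1) e(s²/32) = -4√2 (1 + i)` (`hSum_one_32`);
* `θ(4 γ₀ z + ½) = θ(σ(4z + ½))` with `σ = (5 -2; 8 -3) ∈ Γ₀(8)` and `8(4z + ½) - 3 = 32z + 1`, by
  `thetaMul_one_smul` (`c = 8`, `G(5; 8) = -2√2(1 + i)`), where `θ(4z + ½) = 2θ(16z) - θ(4z)`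
  (`thetaMul_one_half_vadd`);
* the half-power factors are the same `w = 32z + 1` at `c = 32` and `c = 8`:
  `(w/(16i))^{1/2} = 2 (w/(64i))^{1/2}` and `((w/(64i))^{1/2})² = w/(64i)`, and the constants
  multiply to `1` (`(x^{1/2})² = x` is `Complex.cpow_nat_inv_pow`).

Consequences: `congruentCuspForm32 : CuspForm (Γ₀(32)) 2` with function `φ` (so all the
level-`32` Shintani/Kohnen-lift machinery applies to `φ`), `congruentPhi_mem_32`.

No named facts; definitions `gamma0Gen`, `sigma8`, `congruentCuspForm32`.
-/

noncomputable section

open scoped MatrixGroups ModularForm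
open UpperHalfPlane hiding I
open Complex Filter Topology CongruenceSubgroup

namespace Literature.NumberTheory.EllipticCurves.Tunnell1983

open Literature.NumberTheory.EllipticCurves.ModularForms
open Literature.NumberTheory.LFunctions (sum_zmod_eq_sum_range sum_range_mul_eq_sum_sum)

/-! ### Roots of unity -/

/-- `e(1/8) = (√2/2)(1 + i)`. [folklore] -/
theorem cexp_pi_I_div_four : cexp (Real.pi * I / 4) = (Real.sqrt 2 / 2 : ℝ) * (1 + I) := by
  rw [show (Real.pi * I / 4 : ℂ) = ((Real.pi / 4 : ℝ) : ℂ) * I by push_cast; ring, Complex.exp_mul_I]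
  rw [← Complex.ofReal_cos, ← Complex.ofReal_sin, Real.cos_pi_div_four, Real.sin_pi_div_four]
  push_cast
  ring

/-- `e(m/32)` depends only on `m mod 32`: `e((32q + r)/32) = e(r/32)`. [folklore] -/
theorem cexp_div_32 (q r : ℕ) :
    cexp (2 * Real.pi * I * ((32 * q + r : ℕ) : ℂ) / 32) = cexp (2 * Real.pi * I * (r : ℂ) / 32) := by
  refine cexp_eq_cexp_of_sub_eq q ?_
  push_cast; ring

/-- `e(16/32) = -1`. [folklore] -/
theorem cexp_16_div_32 : cexp (2 * Real.pi * I * ((16 : ℕ) : ℂ) / 32) = -1 := by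
  rw [show (2 * Real.pi * I * ((16 : ℕ) : ℂ) / 32 : ℂ) = Real.pi * I by push_cast; ring, Complex.exp_pi_mul_I]

/-- `e(4/32) = e(1/8)`. [folklore] -/
theorem cexp_4_div_32 : cexp (2 * Real.pi * I * ((4 : ℕ) : ℂ) / 32) = (Real.sqrt 2 / 2 : ℝ) * (1 + I) := by
  rw [show (2 * Real.pi * I * ((4 : ℕ) : ℂ) / 32 : ℂ) = Real.pi * I / 4 by push_cast; ring, cexp_pi_I_div_four]

/-- `e(0/32) = 1`. [folklore] -/
theorem cexp_0_div_32 : cexp (2 * Real.pi * I * ((0 : ℕ) : ℂ) / 32) = 1 := by simp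

/-! ### `H(1; 32) = -4√2 (1 + i)` -/

/-- `χ₋₄` on integers by residues. [folklore] -/
theorem chiM4_eq_of_mod (k : ℤ) :
    chiM4 k = if k % 4 = 1 then 1 else if k % 4 = 3 then -1 else 0 := by
  unfold chiM4
  rw [ZMod.χ₄_int_eq_if_mod_four]
  have h4 : k % 4 = 0 ∨ k % 4 = 1 ∨ k % 4 = 2 ∨ k % 4 = 3 := by omega
  rcases h4 with h | h | h | h <;> simp [h] <;> omega

/-- **`H(1; 32) = ∑_{s mod 32} χ₋₄(s + 1) e(s²/32) = -4√2(1 + i)`.** [folklore] -/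
theorem hSum_one_32 : hSum (show 4 ∣ 32 by norm_num) (1 : ZMod 32) = -(4 * Real.sqrt 2 : ℝ) * (1 + I) := by
  have h := hSum_eq_sum_range (c := 32) (show 4 ∣ 32 by norm_num) 1
  rw [Int.cast_one] at h
  rw [h]
  -- period `16`
  set F : ℕ → ℂ := fun n ↦ chiM4 ((n : ℤ) + 1) * cexp (2 * Real.pi * I * ((1 * (n : ℤ) ^ 2 : ℤ) : ℂ) / (32 : ℕ))
    with hF
  have hper : ∀ u j, F (u + 16 * j) = F u := by
    intro u j
    rw [hF]
    dsimp only
    congr 1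
    · rw [show (((u + 16 * j : ℕ) : ℤ) + 1) = ((u : ℤ) + 1) + 4 * (4 * j : ℤ) by push_cast; ring]
      exact chiM4_add_four_mul _ _
    · refine cexp_eq_cexp_of_sub_eq (u * j + 8 * j ^ 2) ?_
      push_cast; field_simp; ring
  have hsplit : ∑ n ∈ Finset.range 32, F n = 2 * ∑ u ∈ Finset.range 16, F u := by
    rw [show (32 : ℕ) = 16 * 2 by norm_num, sum_range_mul_eq_sum_sum 16 2 F]
    have h2 : ∀ u, ∑ v ∈ Finset.range 2, F (u + 16 * v) = 2 * F u := by
      intro u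
      simp only [Finset.sum_range_succ, Finset.sum_range_zero, zero_add, mul_zero, add_zero, mul_one]
      rw [hper u 1, two_mul]
    rw [Finset.sum_congr rfl (fun u _ ↦ h2 u), ← Finset.mul_sum]
  change ∑ n ∈ Finset.range 32, F n = _
  rw [hsplit]
  -- the sixteen terms
  have hval : ∀ n : ℕ, F n = chiM4 ((n : ℤ) + 1) * cexp (2 * Real.pi * I * ((n ^ 2 : ℕ) : ℂ) / 32) := by
    intro n; rw [hF]; dsimp only; push_cast; ring_nf
  simp only [Finset.sum_range_succ, Finset.sum_range_zero, zero_add, hval]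
  simp only [chiM4_eq_of_mod]
  norm_num
  rw [show ((4 : ℂ)) = ((4 : ℕ) : ℂ) by norm_num, show ((16 : ℂ)) = ((16 : ℕ) : ℂ) by norm_num,
    show ((36 : ℂ)) = ((32 * 1 + 4 : ℕ) : ℂ) by norm_num, show ((64 : ℂ)) = ((32 * 2 + 0 : ℕ) : ℂ) by norm_num,
    show ((100 : ℂ)) = ((32 * 3 + 4 : ℕ) : ℂ) by norm_num, show ((144 : ℂ)) = ((32 * 4 + 16 : ℕ) : ℂ) by norm_num,
    show ((196 : ℂ)) = ((32 * 6 + 4 : ℕ) : ℂ) by norm_num]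
  rw [cexp_div_32, cexp_div_32, cexp_div_32, cexp_div_32, cexp_div_32, cexp_4_div_32, cexp_16_div_32,
    cexp_0_div_32]
  push_cast
  ring

/-! ### `G(5; 8) = -2√2 (1 + i)` -/

/-- **`G(5; 8) = ∑_{m mod 8} e(5m²/8) = -2√2 (1 + i)`.** [folklore] -/
theorem quadGaussSum_eight_five : quadGaussSum 8 (5 : ℤ) 0 = -(2 * Real.sqrt 2 : ℝ) * (1 + I) := by
  rw [show ((5 : ℤ) : ZMod 8) = (5 : ZMod 8) by rfl, quadGaussSum_eight_eq']
  have h1 : (ZMod.stdAddChar (5 : ZMod 8) : ℂ) = -((Real.sqrt 2 / 2 : ℝ) * (1 + I)) := by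
    rw [show (5 : ZMod 8) = ((5 : ℤ) : ZMod 8) by rfl, ZMod.stdAddChar_coe]
    rw [show (2 * Real.pi * I * ((5 : ℤ) : ℂ) / (8 : ℕ) : ℂ) = Real.pi * I + Real.pi * I / 4 by push_cast; ring,
      Complex.exp_add, Complex.exp_pi_mul_I, cexp_pi_I_div_four]
    ring
  have h2 : (ZMod.stdAddChar (4 * 5 : ZMod 8) : ℂ) = -1 := by
    rw [show (4 * 5 : ZMod 8) = ((4 : ℤ) : ZMod 8) by decide, ZMod.stdAddChar_coe]
    rw [show (2 * Real.pi * I * ((4 : ℤ) : ℂ) / (8 : ℕ) : ℂ) = Real.pi * I by push_cast; ring, Complex.exp_pi_mul_I]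
  rw [h1, h2]
  push_cast
  ring

/-! ### The generator `γ₀ = (1 0; 32 1)` and `Θ′(γ₀ z)` -/

/-- `γ₀ = (1 0; 32 1)`, a generator of `Γ₀(32)` over `Γ₀(64)`. [folklore] -/
def gamma0Gen : SL(2, ℤ) := ⟨!![1, 0; 32, 1], by norm_num [Matrix.det_fin_two_of]⟩

/-- Entries of `γ₀`. [folklore] -/
@[simp] theorem gamma0Gen_00 : (gamma0Gen 0 0 : ℤ) = 1 := rfl
/-- Entries of `γ₀`. [folklore] -/
@[simp] theorem gamma0Gen_01 : (gamma0Gen 0 1 : ℤ) = 0 := rfl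
/-- Entries of `γ₀`. [folklore] -/
@[simp] theorem gamma0Gen_10 : (gamma0Gen 1 0 : ℤ) = 32 := rfl
/-- Entries of `γ₀`. [folklore] -/
@[simp] theorem gamma0Gen_11 : (gamma0Gen 1 1 : ℤ) = 1 := rfl

/-- `γ₀ ∈ Γ₀(32)`. [folklore] -/
theorem gamma0Gen_mem : gamma0Gen ∈ Gamma0 32 := by
  rw [Gamma0_mem, gamma0Gen_10]; decide

/-- **The terms of the transformed series at `γ₀`** collapse to `8√2(1+i) · Θ′`-terms on `k = 2k'`.
[folklore] -/
theorem transform_term_gamma0Gen (z : ℍ) (k' : ℤ) :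
    ((2 * k' : ℤ) : ℂ) * cexp (Real.pi * I * ((2 * k' : ℤ) : ℂ) ^ 2 * ((((32 : ℕ) : ℂ) * z + 1) / (2 * (32 : ℕ)))) *
        chiGaussSum (show 4 ∣ 32 by norm_num) (1 : ℤ) ((2 * k' : ℤ) : ZMod 32) =
      ((8 * Real.sqrt 2 : ℝ) : ℂ) * (1 + I) * thetaChiTerm z k' := by
  have h4 : 4 ∣ 32 := by norm_num
  have h16 : 16 ∣ 32 := by norm_num
  have e2k : ((2 * k' : ℤ) : ZMod 32) = 2 * (k' : ZMod 32) := by push_cast; ring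
  rw [e2k]
  rcases Int.even_or_odd k' with hk | hk
  · rw [chiGaussSum_eq_zero_of_even h16 h4 odd_one hk, mul_zero]
    rw [thetaChiTerm, chiM4_eq_zero_of_even hk]; ring
  · have had : ((1 : ℤ) : ZMod 32) * ((1 : ℤ) : ZMod 32) = 1 := by push_cast; ring
    have hu := castHom_neg_odd (c := 32) h4 (d := 1) odd_one hk
    rw [chiGaussSum_two_mul_of_odd h4 had hu, Int.cast_one, hSum_one_32]
    have hchar : ((ZMod.χ₄ (-(ZMod.castHom h4 (ZMod 4) ((1 : ZMod 32) * (k' : ZMod 32)))) : ℤ) : ℂ) =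
        -chiM4 k' := by
      unfold chiM4
      rw [one_mul, map_intCast, ← neg_one_mul ((k' : ZMod 4)), map_mul,
        show ZMod.χ₄ (-1 : ZMod 4) = -1 by decide, Int.cast_mul]
      push_cast; ring
    have hprod : cexp (Real.pi * I * ((2 * k' : ℤ) : ℂ) ^ 2 * ((((32 : ℕ) : ℂ) * z + 1) / (2 * (32 : ℕ)))) *
        (ZMod.stdAddChar (-((1 : ZMod 32) * (k' : ZMod 32) ^ 2)) : ℂ) = cexp (2 * Real.pi * I * k' ^ 2 * (z : ℂ)) := by
      have hpsi : (ZMod.stdAddChar (-((1 : ZMod 32) * (k' : ZMod 32) ^ 2)) : ℂ) =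
          cexp (2 * Real.pi * I * ((-(k' ^ 2) : ℤ) : ℂ) / (32 : ℕ)) := by
        rw [← ZMod.stdAddChar_coe]; congr 1; push_cast; ring
      rw [hpsi, ← Complex.exp_add]
      refine cexp_eq_cexp_of_sub_eq 0 ?_
      push_cast; field_simp; ring
    rw [show ((2 * k' : ℤ) : ℂ) * cexp (Real.pi * I * ((2 * k' : ℤ) : ℂ) ^ 2 * ((((32 : ℕ) : ℂ) * z + 1) / (2 * (32 : ℕ)))) *
        ((ZMod.stdAddChar (-((1 : ZMod 32) * (k' : ZMod 32) ^ 2)) : ℂ) *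
          ((ZMod.χ₄ (-(ZMod.castHom h4 (ZMod 4) ((1 : ZMod 32) * (k' : ZMod 32)))) : ℤ) : ℂ) *
          (-(4 * Real.sqrt 2 : ℝ) * (1 + I))) =
        ((2 * k' : ℤ) : ℂ) * ((ZMod.χ₄ (-(ZMod.castHom h4 (ZMod 4) ((1 : ZMod 32) * (k' : ZMod 32)))) : ℤ) : ℂ) *
          (-(4 * Real.sqrt 2 : ℝ) * (1 + I)) *
          (cexp (Real.pi * I * ((2 * k' : ℤ) : ℂ) ^ 2 * ((((32 : ℕ) : ℂ) * z + 1) / (2 * (32 : ℕ)))) *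
            (ZMod.stdAddChar (-((1 : ZMod 32) * (k' : ZMod 32) ^ 2)) : ℂ)) by ring, hprod, hchar, thetaChiTerm]
    push_cast
    ring

/-- **`Θ′(γ₀ z) = -(w/2) (64i/w)^{-1/2} · 8√2(1+i) · Θ′(z)`**, `w = 32z + 1`. [cite: Shimura1973HalfIntegral, §2] -/
theorem thetaChi_gamma0Gen (z : ℍ) :
    thetaChi (gamma0Gen • z) =
      -((((32 : ℕ) : ℂ) * z + 1) / 2) * (1 / (2 * I * (32 : ℕ) / (((32 : ℕ) : ℂ) * z + 1)) ^ (1 / 2 : ℂ)) *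
        (((8 * Real.sqrt 2 : ℝ) : ℂ) * (1 + I)) * thetaChi z := by
  have h4 : 4 ∣ 32 := by norm_num
  have h8 : 8 ∣ 32 := by norm_num
  haveI : NeZero (32 : ℕ) := ⟨by norm_num⟩
  have hlaw := thetaChi_smul_eq_tsum (c := 32) (γ := gamma0Gen) rfl h4 z
  rw [gamma0Gen_11, gamma0Gen_00, Int.cast_one] at hlaw
  rw [hlaw]
  set w : ℂ := ((32 : ℕ) : ℂ) * z + 1 with hw
  have hw_im : 0 < w.im := by have := im_denom_pos (c := 32) 1 z; push_cast at this; exact this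
  set T : ℤ → ℂ := fun k ↦ (k : ℂ) * cexp (Real.pi * I * k ^ 2 * (w / (2 * (32 : ℕ)))) *
    chiGaussSum h4 (1 : ℤ) k with hT
  have heven : HasSum (fun k' : ℤ ↦ T (2 * k')) (((8 * Real.sqrt 2 : ℝ) : ℂ) * (1 + I) * thetaChi z) := by
    have h := (hasSum_thetaChi z).mul_left (((8 * Real.sqrt 2 : ℝ) : ℂ) * (1 + I))
    refine h.congr_fun fun k' ↦ ?_
    rw [hT]
    dsimp only
    have := transform_term_gamma0Gen z k'
    rw [← hw] at this
    push_cast at this ⊢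
    exact this
  have hodd : HasSum (fun k' : ℤ ↦ T (2 * k' + 1)) 0 := by
    have : (fun k' : ℤ ↦ T (2 * k' + 1)) = 0 := by
      funext k'
      rw [hT]
      dsimp only
      rw [chiGaussSum_eq_zero_of_odd h8 h4 _ ⟨k', rfl⟩, mul_zero]
      rfl
    rw [this]
    exact hasSum_zero
  have htot := hasSum_int_even_add_odd heven hodd
  rw [add_zero] at htot
  rw [show (∑' k : ℤ, (k : ℂ) * cexp (Real.pi * I * k ^ 2 * (w / (2 * (32 : ℕ)))) *
      chiGaussSum h4 ((1 : ℤ) : ZMod 32) k) = ∑' k, T k from rfl, htot.tsum_eq]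
  ring

/-! ### `θ(4z + ½) = 2θ(16z) - θ(4z)` and its law under `γ₀` -/

/-- The point `u(z) = 4z + ½`. [folklore] -/
def uPt (z : ℍ) : ℍ := ⟨4 * (z : ℂ) + 1 / 2, by
  have := z.im_pos
  simp only [Complex.add_im, Complex.mul_im, Complex.re_ofNat, UpperHalfPlane.coe_im, Complex.im_ofNat,
    UpperHalfPlane.coe_re, zero_mul, add_zero, Complex.div_ofNat_im, Complex.one_im, zero_div]
  linarith⟩

/-- `(u(z) : ℂ) = 4z + ½`. [folklore] -/
theorem coe_uPt (z : ℍ) : ((uPt z : ℍ) : ℂ) = 4 * (z : ℂ) + 1 / 2 := rfl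

/-- **`θ(4z + ½) = 2θ(16z) - θ(4z)`** (`e^{πi m²} = (-1)^m`: even and odd parts). [folklore] -/
theorem thetaMul_one_uPt (z : ℍ) : thetaMul 1 (uPt z) = 2 * thetaMul 16 z - thetaMul 4 z := by
  set f : ℤ → ℂ := fun m ↦ cexp (2 * Real.pi * I * ((1 * m ^ 2 : ℤ) : ℂ) * (uPt z : ℂ)) with hf
  have htot : HasSum f (thetaMul 1 (uPt z)) := hasSum_thetaMul one_pos (uPt z)
  have heven : HasSum (fun k : ℤ ↦ f (2 * k)) (thetaMul 16 z) := by
    have h := hasSum_thetaMul (t := 16) (by norm_num) z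
    refine h.congr_fun fun k ↦ ?_
    rw [hf]
    dsimp only
    rw [coe_uPt]
    refine (cexp_eq_cexp_of_sub_eq (2 * k ^ 2) ?_)
    push_cast; ring
  have hodd : HasSum (fun k : ℤ ↦ f (2 * k + 1)) (-(thetaMul 4 z - thetaMul 16 z)) := by
    have h := (hasSum_thetaMul_odd (t := 4) (by norm_num) z).neg
    rw [show 4 * 4 = 16 from rfl] at h
    refine h.congr_fun fun k ↦ ?_
    rw [hf]
    dsimp only
    rw [coe_uPt]
    have : cexp (2 * Real.pi * I * ((1 * (2 * k + 1) ^ 2 : ℤ) : ℂ) * (4 * (z : ℂ) + 1 / 2)) =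
        cexp (2 * Real.pi * I * ((4 * (2 * k + 1) ^ 2 : ℤ) : ℂ) * (z : ℂ)) * cexp (Real.pi * I) := by
      rw [← Complex.exp_add]
      refine cexp_eq_cexp_of_sub_eq (2 * k ^ 2 + 2 * k) ?_
      push_cast; ring
    rw [this, Complex.exp_pi_mul_I]
    ring
  have h2 := hasSum_int_even_add_odd heven hodd
  rw [htot.unique h2]
  ring

/-- `σ = (5 -2; 8 -3) ∈ Γ₀(8)`. [folklore] -/
def sigma8 : SL(2, ℤ) := ⟨!![5, -2; 8, -3], by norm_num [Matrix.det_fin_two_of]⟩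

/-- Entries of `σ`. [folklore] -/
@[simp] theorem sigma8_00 : (sigma8 0 0 : ℤ) = 5 := rfl
/-- Entries of `σ`. [folklore] -/
@[simp] theorem sigma8_01 : (sigma8 0 1 : ℤ) = -2 := rfl
/-- Entries of `σ`. [folklore] -/
@[simp] theorem sigma8_10 : (sigma8 1 0 : ℤ) = 8 := rfl
/-- Entries of `σ`. [folklore] -/
@[simp] theorem sigma8_11 : (sigma8 1 1 : ℤ) = -3 := rfl

/-- **`σ · u(z) = u(γ₀ z)`**: `(5u - 2)/(8u - 3) = 4 γ₀ z + ½` for `u = 4z + ½`. [folklore] -/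
theorem sigma8_smul_uPt (z : ℍ) : sigma8 • uPt z = uPt (gamma0Gen • z) := by
  apply UpperHalfPlane.ext
  rw [coe_smul_eq' sigma8 (uPt z), coe_uPt, coe_uPt, coe_smul_eq' gamma0Gen z]
  simp only [sigma8_00, sigma8_01, sigma8_10, sigma8_11, gamma0Gen_00, gamma0Gen_01, gamma0Gen_10,
    gamma0Gen_11]
  have hw : (32 : ℂ) * z + 1 ≠ 0 := by
    have := im_denom_pos (c := 32) 1 z
    intro h; push_cast at this; rw [h] at this; simp at this
  push_cast
  have hw' : (8 : ℂ) * (4 * (z : ℂ) + 1 / 2) + -3 ≠ 0 := by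
    rw [show (8 : ℂ) * (4 * (z : ℂ) + 1 / 2) + -3 = 32 * z + 1 by ring]; exact hw
  rw [div_eq_iff hw', show (8 : ℂ) * (4 * (z : ℂ) + 1 / 2) + -3 = 32 * z + 1 by ring, add_mul, mul_assoc,
    div_mul_cancel₀ _ hw]
  ring

/-- **`θ(u(γ₀ z)) = (16i/w)^{-1/2} G(5; 8) θ(u(z))`**, `w = 32z + 1`. [cite: Shimura1973HalfIntegral, §1] -/
theorem thetaMul_one_uPt_gamma0Gen (z : ℍ) :
    thetaMul 1 (uPt (gamma0Gen • z)) =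
      1 / (2 * I * (8 : ℕ) / (((32 : ℕ) : ℂ) * z + 1)) ^ (1 / 2 : ℂ) * quadGaussSum 8 (5 : ℤ) 0 *
        thetaMul 1 (uPt z) := by
  haveI : NeZero (8 : ℕ) := ⟨by norm_num⟩
  rw [← sigma8_smul_uPt, thetaMul_one_smul (γ := sigma8) (c := 8) rfl (by norm_num) (uPt z)]
  rw [sigma8_11, sigma8_00, coe_uPt]
  congr 3
  push_cast
  ring

/-! ### `φ(γ₀ z) = (32 z + 1)² φ(z)` -/

/-- `φ = ½ Θ′ · θ(u(z))`. [cite: Tunnell1983Congruent, p. 325] -/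
theorem congruentPhi_eq_half_thetaChi_mul (z : ℍ) :
    congruentPhi z = (1 / 2 : ℂ) * thetaChi z * thetaMul 1 (uPt z) := by
  rw [congruentPhi, two_thirtytwo_sub_eight_eq_half_thetaChi, thetaMul_one_uPt]

/-- `(4x)^{1/2} = 2 x^{1/2}`. [folklore] -/
theorem cpow_half_four_mul (x : ℂ) : ((4 : ℂ) * x) ^ (1 / 2 : ℂ) = 2 * x ^ (1 / 2 : ℂ) := by
  rcases eq_or_ne x 0 with rfl | hx
  · simp
  · rw [Complex.cpow_def_of_ne_zero (mul_ne_zero (by norm_num) hx), Complex.cpow_def_of_ne_zero hx,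
      show (4 : ℂ) = ((4 : ℝ) : ℂ) by norm_num, Complex.log_ofReal_mul (by norm_num) hx, add_mul,
      Complex.exp_add]
    congr 1
    rw [show (Real.log 4 : ℂ) * (1 / 2) = ((Real.log 4 / 2 : ℝ) : ℂ) by push_cast; ring, ← Complex.ofReal_exp,
      show Real.log 4 / 2 = Real.log 2 by
        rw [show (4 : ℝ) = 2 ^ 2 by norm_num, Real.log_pow]; ring,
      Real.exp_log two_pos]
    norm_num

/-- **`φ(γ₀ z) = (32 z + 1)² φ(z)`** for `γ₀ = (1 0; 32 1)`. [cite: Tunnell1983Congruent, p. 325] -/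
theorem congruentPhi_gamma0Gen (z : ℍ) :
    congruentPhi (gamma0Gen • z) = ((32 : ℂ) * z + 1) ^ 2 * congruentPhi z := by
  rw [congruentPhi_eq_half_thetaChi_mul, congruentPhi_eq_half_thetaChi_mul, thetaChi_gamma0Gen,
    thetaMul_one_uPt_gamma0Gen, quadGaussSum_eight_five]
  set w : ℂ := ((32 : ℕ) : ℂ) * z + 1 with hw
  have hw0 : w ≠ 0 := by
    have := im_denom_pos (c := 32) 1 z
    intro h; rw [hw] at h; push_cast at this h; rw [h] at this; simp at this
  set Q : ℂ := (2 * I * (32 : ℕ) / w) ^ (1 / 2 : ℂ) with hQ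
  have hQ8 : (2 * I * (8 : ℕ) / w) ^ (1 / 2 : ℂ) = Q / 2 := by
    rw [hQ, show (2 * I * (32 : ℕ) / w : ℂ) = 4 * (2 * I * (8 : ℕ) / w) by push_cast; ring, cpow_half_four_mul]
    ring
  have hQ2 : Q ^ 2 = 64 * I / w := by
    rw [hQ, show ((1 : ℂ) / 2) = ((2 : ℕ) : ℂ)⁻¹ by norm_num, Complex.cpow_nat_inv_pow _ two_ne_zero]
    push_cast
    ring
  have hI0 : (I : ℂ) ≠ 0 := Complex.I_ne_zero
  have hQ0 : Q ≠ 0 := by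
    intro h
    have : Q ^ 2 = 0 := by rw [h]; ring
    rw [hQ2] at this
    field_simp at this
    norm_num at this
  rw [hQ8]
  have hs2 : ((Real.sqrt 2 : ℝ) : ℂ) ^ 2 = 2 := by exact_mod_cast Real.sq_sqrt (by norm_num : (0:ℝ) ≤ 2)
  have hw32 : ((32 : ℂ) * z + 1) = w := by rw [hw]; push_cast; ring
  rw [hw32]
  push_cast
  field_simp
  rw [hQ2]
  field_simp
  have hI : I ^ 2 = -1 := Complex.I_sq
  linear_combination ((32 * I + 16 * I ^ 2 + 16) * (thetaChi z * thetaMul 1 (uPt z))) * hs2 +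
    (32 * (thetaChi z * thetaMul 1 (uPt z))) * hI

/-! ### Level `32` -/

/-- **`Γ₀(32) = Γ₀(64) ∪ Γ₀(64) γ₀`**: an element of `Γ₀(32)` not in `Γ₀(64)` is `g γ₀` with `g ∈ Γ₀(64)`.
[folklore] -/
theorem exists_mul_gamma0Gen_of_not_mem {γ : SL(2, ℤ)} (hγ : γ ∈ Gamma0 32) (h64 : γ ∉ Gamma0 64) :
    ∃ g ∈ Gamma0 64, γ = g * gamma0Gen := by
  refine ⟨γ * gamma0Gen⁻¹, ?_, by rw [inv_mul_cancel_right]⟩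
  rw [Gamma0_mem] at hγ h64 ⊢
  have h32 : (32 : ℤ) ∣ (γ 1 0 : ℤ) := (ZMod.intCast_zmod_eq_zero_iff_dvd _ 32).mp hγ
  have hn64 : ¬ (64 : ℤ) ∣ (γ 1 0 : ℤ) := fun h ↦ h64 ((ZMod.intCast_zmod_eq_zero_iff_dvd _ 64).mpr h)
  have hdet := Literature.NumberTheory.EllipticCurves.ModularForms.det_eq_one' γ
  -- the `(1,0)` entry of `γ γ₀⁻¹` is `c - 32 d`
  have hinv : (gamma0Gen⁻¹ : SL(2, ℤ)) = ⟨!![1, 0; -32, 1], by norm_num [Matrix.det_fin_two_of]⟩ := by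
    ext i j
    rw [Matrix.SpecialLinearGroup.coe_inv]
    fin_cases i <;> fin_cases j <;> simp [Matrix.adjugate_fin_two, gamma0Gen]
  have hentry : ((γ * gamma0Gen⁻¹ : SL(2, ℤ)) 1 0 : ℤ) = γ 1 0 - 32 * γ 1 1 := by
    rw [hinv, Matrix.SpecialLinearGroup.coe_mul]
    simp [Matrix.mul_apply, Fin.sum_univ_two]
    ring
  rw [hentry]
  apply (ZMod.intCast_zmod_eq_zero_iff_dvd _ 64).mpr
  obtain ⟨q, hq⟩ := h32
  have hqodd : Odd q := by
    by_contra h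
    rw [Int.not_odd_iff_even] at h
    obtain ⟨r, hr⟩ := h
    exact hn64 ⟨r, by rw [hq, hr]; ring⟩
  -- `d` is odd (det = 1 with `c` even)
  have hdodd : Odd (γ 1 1 : ℤ) := by
    by_contra h
    rw [Int.not_odd_iff_even] at h
    have : Even ((γ 0 0 : ℤ) * γ 1 1 - γ 0 1 * γ 1 0) := by
      rw [hq]; exact (h.mul_left _).sub ⟨γ 0 1 * 16 * q, by ring⟩
    rw [hdet] at this
    exact Int.not_even_one this
  obtain ⟨a, ha⟩ := hqodd
  obtain ⟨b, hb⟩ := hdodd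
  exact ⟨a - b, by rw [hq, ha, hb]; ring⟩

/-- **Weight-`2` automorphy of `φ` on all of `Γ₀(32)`**: `φ(γ z) = (cz + d)² φ(z)`. [cite: Tunnell1983Congruent, p. 325] -/
theorem congruentPhi_smul_of_mem_32 {γ : SL(2, ℤ)} (hγ : γ ∈ Gamma0 32) (z : ℍ) :
    congruentPhi (γ • z) = (((γ 1 0 : ℤ) : ℂ) * z + ((γ 1 1 : ℤ) : ℂ)) ^ 2 * congruentPhi z := by
  have hmem64 := halfIntCuspForms_le_halfIntModularForms 4 64 1 congruentPhi_mem_64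
  by_cases h64 : γ ∈ Gamma0 64
  · exact apply_smul_eq_of_mem_four (by norm_num) hmem64 h64 z
  · obtain ⟨g, hg, rfl⟩ := exists_mul_gamma0Gen_of_not_mem hγ h64
    rw [mul_smul, apply_smul_eq_of_mem_four (by norm_num) hmem64 hg (gamma0Gen • z), congruentPhi_gamma0Gen]
    -- the cocycle of denominators
    have hcoc : (((g 1 0 : ℤ) : ℂ) * ((gamma0Gen • z : ℍ) : ℂ) + ((g 1 1 : ℤ) : ℂ)) * ((32 : ℂ) * z + 1) =
        ((((g * gamma0Gen : SL(2, ℤ)) 1 0 : ℤ) : ℂ) * z + (((g * gamma0Gen : SL(2, ℤ)) 1 1 : ℤ) : ℂ)) := by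
      rw [coe_smul_eq' gamma0Gen z, Matrix.SpecialLinearGroup.coe_mul]
      simp only [gamma0Gen_00, gamma0Gen_01, gamma0Gen_10, gamma0Gen_11, Matrix.mul_apply, Fin.sum_univ_two]
      have hw : (32 : ℂ) * z + 1 ≠ 0 := by
        have := im_denom_pos (c := 32) 1 z
        intro h; push_cast at this; rw [h] at this; simp at this
      push_cast
      rw [add_mul, mul_assoc, div_mul_cancel₀ _ hw]
      ring
    rw [← hcoc]
    ring

/-- **`φ ∈ S_{4/2}(32, 1)`** (level `32`, trivial character). [cite: Tunnell1983Congruent, p. 325] -/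
theorem congruentPhi_mem_32 : congruentPhi ∈ halfIntCuspForms 4 32 1 := by
  refine ⟨congruentPhi_mem_64.1, fun γ hγ z ↦ ?_, congruentPhi_mem_64.2.2⟩
  rw [congruentPhi_smul_of_mem_32 hγ z, shimuraTheta_smul_eq_thetaFactor (by norm_num : 4 ∣ 32) hγ z, mul_pow,
    thetaFactor_pow_four (gcd_c_d_eq_one γ), MulChar.one_apply (isUnit_d_of_mem_Gamma0 hγ)]
  ring

/-- **The congruent-number newform as a weight-`2` cusp form ON `Γ₀(32)`** (its true level).
[cite: Tunnell1983Congruent, p. 325] -/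
def congruentCuspForm32 : CuspForm (Gamma0 32) 2 := cuspFormTwoOfMem (by norm_num) congruentPhi congruentPhi_mem_32

/-- The function of `congruentCuspForm32` is `φ`. [folklore] -/
@[simp] theorem congruentCuspForm32_apply (z : ℍ) : congruentCuspForm32 z = congruentPhi z := rfl

/-- `⇑congruentCuspForm32 = ⇑congruentCuspForm` (`= φ`). [folklore] -/
theorem coe_congruentCuspForm32 : ⇑congruentCuspForm32 = ⇑congruentCuspForm := rfl

/-- The modular symbols of the level-`32` and level-`64` realisations agree. [folklore] -/
theorem modularSymbol_congruentCuspForm32 (r : ℚ) :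
    modularSymbol congruentCuspForm32 r = modularSymbol congruentCuspForm r := rfl

/-- The twisted symbol sums agree. [folklore] -/
theorem twistedSymbolSum_congruentCuspForm32 {m : ℕ} [NeZero m] (χ : DirichletCharacter ℂ m) :
    twistedSymbolSum congruentCuspForm32 χ = twistedSymbolSum congruentCuspForm χ := rfl

end Literature.NumberTheory.EllipticCurves.Tunnell1983
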